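import Summits.FinalStateConjecture.FinalStateConjecture.Statement
import Summits.FinalStateConjecture.FinalStateConjecture.Theorems.PhaseMixingCaptureCaptureSufficesTameKickReduction
import HarnessLib

/-!
# `CaptureSufficesTame` (stmt-FinalStateConjecture-17270, route PhaseMixingCapture, rank 6),
# line `SketchIdeator2` (card `only-the-third-law-is-generic`): the SETTLING-KICK reduction (skeleton v3)

Skeleton v2 of the line (leads a0/c1) had three registered stubs: A = item stmt-17296 verbatim (every censored
MGHD carries an honest C⁰ final-state decomposition), U = item stmt-17298 verbatim (an honest C⁰ configuration
with sub-extremal LABELS upgrades to the summit's honest C² decomposition) and the ∃-form kick R =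
`stub_unparkingKick`. The sanity of U hinges on an open C⁰ label-rigidity question (do honest C⁰ Kerr charts pin
their labels `(Mᵢ, aᵢ)`? — `Cruxes/CaptureSufficesTame/LABEL-RIGIDITY-C0{,-c1}.md`): with floppy labels U is false
at every censored extremal-settling development and the line dies at U for a reason foreign to its idea.

Skeleton v3 (lead c2) folds U into the kick. Its kick R⁺ = `stub_settlingKick` asks the small members of the
witness curve to be censored and SETTLED — every MGHD has complete `𝓘⁺` and, whenever it carries SOME honest C⁰
endpoint configuration, carries an honest C² final-state decomposition with sub-extremal holes — so that no C⁰
label is ever read. This file is the v3 REDUCTION (playbook: reduction theorem first, hypotheses = the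
registered stub texts verbatim), sorry-free, definition-free and `Theses`-free:

* `finalStateConjecture_of_settlingKick` — the re-typed summit from (W) tame weak cosmic censorship (VERBATIM the
  body of the crux's hypothesis `WeakCosmicCensorshipTame`), (A) VERBATIM item stmt-17296 and (R⁺) the settling
  kick; the crux follows in the skeleton by `fun _ _ hW ↦ …`.
* `settlingKick_of_finalStateConjecture` — **R⁺ is NECESSARY**: the summit implies the settling kick (the
  summit's own tame witness curve through the base datum is a settling kick, `ε₀ := 1`). So R⁺ cannot be refuted
  short of refuting the summit, and modulo (W) and (A) the kick IS the summit
  (`finalStateConjecture_iff_settlingKick`).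
* `hasExhaustiveCharts_ofLE`, `isFutureOriented_ofLE` — honesty of a decomposition survives lowering the
  differentiability order with the same charts (`FinalStateDecomposition.ofLE`); whence
  `unparkingKick_of_finalStateConjecture` — v2's kick R is necessary as well (an honest C² sub-extremal
  decomposition is, read in C⁰, an honest C⁰ configuration with sub-extremal labels).

Nothing here is analysis: (A) and (R⁺) carry the dynamical content (attraction of censored exteriors to the
closed Kerr family; genericity of the third law along censored curves followed by the red-shift upgrade).
-/

set_option linter.dupNamespace false

noncomputable section

open scoped Manifold ContDiff Topology ENNReal
open Set Function Filter

namespace Summit.FinalStateConjecture.FinalStateConjecture.Theorems.PhaseMixingCaptureCaptureSufficesTame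

open Literature.Geometry.Lorentzian
open Summit.FinalStateConjecture (HasCompleteNullInfinity exteriorOf RaysStayInClosure HasExhaustiveCharts
  IsFutureOriented certifiedLate certifiedSlab)

/-! ## Honesty survives lowering the differentiability order -/

section OfLE

variable {𝓢 : Spacetime.{0} 4} {O : Set 𝓢.carrier} {k k' : ℕ}

/-- **Exhaustive charts survive lowering the order.** `FinalStateDecomposition.ofLE` keeps every chart, label
and domain, so the certified late regions and slabs are literally the same sets, the honest radii `Rᵢ` serve
again, and the truncated `Cᵏ` deviations are dominated by the `Cᵏ'` ones (`supCkENorm_mono_right`).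
[folklore] -/
theorem hasExhaustiveCharts_ofLE (d : FinalStateDecomposition 𝓢 O k') (h : k ≤ k')
    (hd : HasExhaustiveCharts d) : HasExhaustiveCharts (d.ofLE h) := by
  obtain ⟨R, hR, hconv, hcov⟩ := hd
  refine ⟨R, hR, fun i ↦ ?_, hcov⟩
  exact tendsto_of_tendsto_of_tendsto_of_le_of_le tendsto_const_nhds (hconv i) (fun _ ↦ zero_le)
    fun _ ↦ supCkENorm_mono_right _ h _

/-- **Future orientation of the charts does not see the order** (same motions, same charts, same labels).
[folklore] -/
theorem isFutureOriented_ofLE (d : FinalStateDecomposition 𝓢 O k') (h : k ≤ k') :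
    IsFutureOriented (d.ofLE h) ↔ IsFutureOriented d :=
  Iff.rfl

end OfLE

/-! ## The v3 reduction and the necessity of the kick -/

/-- **The re-typed summit from (W) tame weak cosmic censorship, (A) pointwise honest C⁰ settling of censored
MGHDs (VERBATIM item stmt-17296) and (R⁺) SETTLING KICKS ALONG CENSORED CURVES** (the line's registered
`stub_settlingKick`, skeleton v3): along every tame admissible curve of censored data (told immersed-injective, or
constant) whose base datum is not (censored ∧ settled) there are a tame injective immersed admissible curve through
the base and an `ε₀ > 0` such that every member with `0 < ‖c‖ < ε₀` is censored and settled — every MGHD has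
complete `𝓘⁺` and, whenever it carries some honest C⁰ endpoint configuration, carries an honest C² final-state
decomposition with sub-extremal holes. Proof: (W) ⟹ tame-generic (censored ∧ settled) by the kick composition
`isTameChristodoulouGeneric_of_relativeKick`; pointwise, censored ∧ settled ⟹ the summit's matrix because (A)
supplies the honest C⁰ configuration the settled clause consumes. [folklore] -/
theorem finalStateConjecture_of_settlingKick :
    (∀ (X : Type) [TopologicalSpace X] [ChartedSpace E3 X] [IsManifold (𝓡 3) ∞ X] [T2Space X]
      [SecondCountableTopology X] [ConnectedSpace X],
      InitialDataSet.IsTameChristodoulouGeneric (admissibleVacuumData X)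
        (fun D ↦ (∃ 𝒟 : VacuumCauchyDevelopment D, 𝒟.IsMaximal) ∧
          ∀ 𝒟 : VacuumCauchyDevelopment D, 𝒟.IsMaximal →
            HasCompleteNullInfinity 𝒟.toCauchyDevelopment) 1) →
    (∀ (X : Type) [TopologicalSpace X] [ChartedSpace E3 X] [IsManifold (𝓡 3) ∞ X] [T2Space X]
      [SecondCountableTopology X] [ConnectedSpace X],
      ∀ D ∈ admissibleVacuumData X, ∀ 𝒟 : VacuumCauchyDevelopment D, 𝒟.IsMaximal →
        HasCompleteNullInfinity 𝒟.toCauchyDevelopment →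
          ∃ (O : Set 𝒟.carrier) (d : FinalStateDecomposition 𝒟.toSpacetime O 0),
            O = exteriorOf 𝒟.toCauchyDevelopment d.charted ∧ RaysStayInClosure 𝒟.toCauchyDevelopment O ∧
              HasExhaustiveCharts d ∧ IsFutureOriented d) →
    (∀ (X : Type) [TopologicalSpace X] [ChartedSpace E3 X] [IsManifold (𝓡 3) ∞ X] [T2Space X]
      [SecondCountableTopology X] [ConnectedSpace X],
      ∀ (e : AFEnd X) (F : EuclideanSpace ℝ (Fin 1) → InitialDataSet (𝓡 3) X),
        InitialDataSet.IsTameDataFamily e 1 F →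
          ((InitialDataSet.IsImmersedAtZero 1 F ∧ Function.Injective F) ∨ ∀ c, F c = F 0) →
          (∀ c, F c ∈ admissibleVacuumData X) →
          (∀ c ≠ 0, (∃ 𝒟 : VacuumCauchyDevelopment (F c), 𝒟.IsMaximal) ∧
              ∀ 𝒟 : VacuumCauchyDevelopment (F c), 𝒟.IsMaximal →
                HasCompleteNullInfinity 𝒟.toCauchyDevelopment) →
          ¬ (((∃ 𝒟 : VacuumCauchyDevelopment (F 0), 𝒟.IsMaximal) ∧
                ∀ 𝒟 : VacuumCauchyDevelopment (F 0), 𝒟.IsMaximal →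
                  HasCompleteNullInfinity 𝒟.toCauchyDevelopment) ∧
              ∀ 𝒟 : VacuumCauchyDevelopment (F 0), 𝒟.IsMaximal →
                HasCompleteNullInfinity 𝒟.toCauchyDevelopment ∧
                  ((∃ (O : Set 𝒟.carrier) (d₀ : FinalStateDecomposition 𝒟.toSpacetime O 0),
                      O = exteriorOf 𝒟.toCauchyDevelopment d₀.charted ∧
                        RaysStayInClosure 𝒟.toCauchyDevelopment O ∧ HasExhaustiveCharts d₀ ∧
                          IsFutureOriented d₀) →
                    ∃ (O : Set 𝒟.carrier) (d : FinalStateDecomposition 𝒟.toSpacetime O 2),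
                      (∀ i, Kerr.IsSubextremal (d.mass i) (d.spin i)) ∧
                        O = exteriorOf 𝒟.toCauchyDevelopment d.charted ∧
                          RaysStayInClosure 𝒟.toCauchyDevelopment O ∧ HasExhaustiveCharts d ∧
                            IsFutureOriented d)) →
          ∃ (e' : AFEnd X) (F' : EuclideanSpace ℝ (Fin 1) → InitialDataSet (𝓡 3) X),
            InitialDataSet.IsTameDataFamily e' 1 F' ∧ F' 0 = F 0 ∧ Function.Injective F' ∧
              InitialDataSet.IsImmersedAtZero 1 F' ∧ (∀ c, F' c ∈ admissibleVacuumData X) ∧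
              ∃ ε₀ > (0 : ℝ), ∀ c : EuclideanSpace ℝ (Fin 1), c ≠ 0 → ‖c‖ < ε₀ →
                ((∃ 𝒟 : VacuumCauchyDevelopment (F' c), 𝒟.IsMaximal) ∧
                    ∀ 𝒟 : VacuumCauchyDevelopment (F' c), 𝒟.IsMaximal →
                      HasCompleteNullInfinity 𝒟.toCauchyDevelopment) ∧
                  ∀ 𝒟 : VacuumCauchyDevelopment (F' c), 𝒟.IsMaximal →
                    HasCompleteNullInfinity 𝒟.toCauchyDevelopment ∧
                      ((∃ (O : Set 𝒟.carrier) (d₀ : FinalStateDecomposition 𝒟.toSpacetime O 0),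
                          O = exteriorOf 𝒟.toCauchyDevelopment d₀.charted ∧
                            RaysStayInClosure 𝒟.toCauchyDevelopment O ∧ HasExhaustiveCharts d₀ ∧
                              IsFutureOriented d₀) →
                        ∃ (O : Set 𝒟.carrier) (d : FinalStateDecomposition 𝒟.toSpacetime O 2),
                          (∀ i, Kerr.IsSubextremal (d.mass i) (d.spin i)) ∧
                            O = exteriorOf 𝒟.toCauchyDevelopment d.charted ∧
                              RaysStayInClosure 𝒟.toCauchyDevelopment O ∧ HasExhaustiveCharts d ∧
                                IsFutureOriented d)) →
    _root_.FinalStateConjecture := by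
  intro hW hA hR X _ _ _ _ _ _
  have h𝓓 : ∀ d ∈ admissibleVacuumData X,
      ∃ e : AFEnd X, e.IsSoleEnd ∧ ∃ M : ℝ, e.IsStronglyAsymptoticallyFlatDR d M :=
    fun d hd ↦ exists_isSoleEnd_of_mem_admissibleVacuumData hd
  -- tame-generic (censored ∧ settled), by the kick composition along censored curves
  have gS : InitialDataSet.IsTameChristodoulouGeneric (admissibleVacuumData X)
      (fun D ↦ ((∃ 𝒟 : VacuumCauchyDevelopment D, 𝒟.IsMaximal) ∧
          ∀ 𝒟 : VacuumCauchyDevelopment D, 𝒟.IsMaximal →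
            HasCompleteNullInfinity 𝒟.toCauchyDevelopment) ∧
        ∀ 𝒟 : VacuumCauchyDevelopment D, 𝒟.IsMaximal →
          HasCompleteNullInfinity 𝒟.toCauchyDevelopment ∧
            ((∃ (O : Set 𝒟.carrier) (d₀ : FinalStateDecomposition 𝒟.toSpacetime O 0),
                O = exteriorOf 𝒟.toCauchyDevelopment d₀.charted ∧
                  RaysStayInClosure 𝒟.toCauchyDevelopment O ∧ HasExhaustiveCharts d₀ ∧
                    IsFutureOriented d₀) →
              ∃ (O : Set 𝒟.carrier) (d : FinalStateDecomposition 𝒟.toSpacetime O 2),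
                (∀ i, Kerr.IsSubextremal (d.mass i) (d.spin i)) ∧
                  O = exteriorOf 𝒟.toCauchyDevelopment d.charted ∧
                    RaysStayInClosure 𝒟.toCauchyDevelopment O ∧ HasExhaustiveCharts d ∧
                      IsFutureOriented d)) 1 :=
    isTameChristodoulouGeneric_of_relativeKick h𝓓 (hW X) (hR X)
  -- pointwise upgrade to the summit's matrix: (A) supplies the honest C⁰ configuration settled consumes
  refine gS.mono fun D hD hDS ↦ ⟨hDS.1.1, fun 𝒟 hmax ↦ ⟨hDS.1.2 𝒟 hmax, ?_⟩⟩
  exact (hDS.2 𝒟 hmax).2 (hA X D hD 𝒟 hmax (hDS.1.2 𝒟 hmax))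

/-- **The settling kick R⁺ is NECESSARY: the summit implies it.** If the base datum `F 0` is not
(censored ∧ settled) it fails the summit's matrix (which implies censored ∧ settled pointwise — settled even
unconditionally), so the summit's tame genericity hands an end `e'` and a tame injective immersed admissible curve
`F'` through `F 0` all of whose members off `0` satisfy the summit's matrix, hence are censored and settled;
`ε₀ := 1`. The given censored base curve `F` is not used. Consequently R⁺ cannot be refuted short of refuting
the summit (it is summit-implied, like the crux itself). [folklore] -/
theorem settlingKick_of_finalStateConjecture (h : _root_.FinalStateConjecture) :
    ∀ (X : Type) [TopologicalSpace X] [ChartedSpace E3 X] [IsManifold (𝓡 3) ∞ X] [T2Space X]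
      [SecondCountableTopology X] [ConnectedSpace X],
      ∀ (e : AFEnd X) (F : EuclideanSpace ℝ (Fin 1) → InitialDataSet (𝓡 3) X),
        InitialDataSet.IsTameDataFamily e 1 F →
          ((InitialDataSet.IsImmersedAtZero 1 F ∧ Function.Injective F) ∨ ∀ c, F c = F 0) →
          (∀ c, F c ∈ admissibleVacuumData X) →
          (∀ c ≠ 0, (∃ 𝒟 : VacuumCauchyDevelopment (F c), 𝒟.IsMaximal) ∧
              ∀ 𝒟 : VacuumCauchyDevelopment (F c), 𝒟.IsMaximal →
                HasCompleteNullInfinity 𝒟.toCauchyDevelopment) →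
          ¬ (((∃ 𝒟 : VacuumCauchyDevelopment (F 0), 𝒟.IsMaximal) ∧
                ∀ 𝒟 : VacuumCauchyDevelopment (F 0), 𝒟.IsMaximal →
                  HasCompleteNullInfinity 𝒟.toCauchyDevelopment) ∧
              ∀ 𝒟 : VacuumCauchyDevelopment (F 0), 𝒟.IsMaximal →
                HasCompleteNullInfinity 𝒟.toCauchyDevelopment ∧
                  ((∃ (O : Set 𝒟.carrier) (d₀ : FinalStateDecomposition 𝒟.toSpacetime O 0),
                      O = exteriorOf 𝒟.toCauchyDevelopment d₀.charted ∧
                        RaysStayInClosure 𝒟.toCauchyDevelopment O ∧ HasExhaustiveCharts d₀ ∧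
                          IsFutureOriented d₀) →
                    ∃ (O : Set 𝒟.carrier) (d : FinalStateDecomposition 𝒟.toSpacetime O 2),
                      (∀ i, Kerr.IsSubextremal (d.mass i) (d.spin i)) ∧
                        O = exteriorOf 𝒟.toCauchyDevelopment d.charted ∧
                          RaysStayInClosure 𝒟.toCauchyDevelopment O ∧ HasExhaustiveCharts d ∧
                            IsFutureOriented d)) →
          ∃ (e' : AFEnd X) (F' : EuclideanSpace ℝ (Fin 1) → InitialDataSet (𝓡 3) X),
            InitialDataSet.IsTameDataFamily e' 1 F' ∧ F' 0 = F 0 ∧ Function.Injective F' ∧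
              InitialDataSet.IsImmersedAtZero 1 F' ∧ (∀ c, F' c ∈ admissibleVacuumData X) ∧
              ∃ ε₀ > (0 : ℝ), ∀ c : EuclideanSpace ℝ (Fin 1), c ≠ 0 → ‖c‖ < ε₀ →
                ((∃ 𝒟 : VacuumCauchyDevelopment (F' c), 𝒟.IsMaximal) ∧
                    ∀ 𝒟 : VacuumCauchyDevelopment (F' c), 𝒟.IsMaximal →
                      HasCompleteNullInfinity 𝒟.toCauchyDevelopment) ∧
                  ∀ 𝒟 : VacuumCauchyDevelopment (F' c), 𝒟.IsMaximal →
                    HasCompleteNullInfinity 𝒟.toCauchyDevelopment ∧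
                      ((∃ (O : Set 𝒟.carrier) (d₀ : FinalStateDecomposition 𝒟.toSpacetime O 0),
                          O = exteriorOf 𝒟.toCauchyDevelopment d₀.charted ∧
                            RaysStayInClosure 𝒟.toCauchyDevelopment O ∧ HasExhaustiveCharts d₀ ∧
                              IsFutureOriented d₀) →
                        ∃ (O : Set 𝒟.carrier) (d : FinalStateDecomposition 𝒟.toSpacetime O 2),
                          (∀ i, Kerr.IsSubextremal (d.mass i) (d.spin i)) ∧
                            O = exteriorOf 𝒟.toCauchyDevelopment d.charted ∧
                              RaysStayInClosure 𝒟.toCauchyDevelopment O ∧ HasExhaustiveCharts d ∧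
                                IsFutureOriented d) := by
  intro X _ _ _ _ _ _ e F _hF _hdich hadm _hcens hbase
  -- the summit's matrix at a datum implies censored ∧ settled there
  have key : ∀ D : InitialDataSet (𝓡 3) X,
      ((∃ 𝒟 : VacuumCauchyDevelopment D, 𝒟.IsMaximal) ∧
        ∀ 𝒟 : VacuumCauchyDevelopment D, 𝒟.IsMaximal →
          HasCompleteNullInfinity 𝒟.toCauchyDevelopment ∧
            ∃ (O : Set 𝒟.carrier) (d : FinalStateDecomposition 𝒟.toSpacetime O 2),
              (∀ i, Kerr.IsSubextremal (d.mass i) (d.spin i)) ∧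
                O = exteriorOf 𝒟.toCauchyDevelopment d.charted ∧
                  RaysStayInClosure 𝒟.toCauchyDevelopment O ∧ HasExhaustiveCharts d ∧
                    IsFutureOriented d) →
      ((∃ 𝒟 : VacuumCauchyDevelopment D, 𝒟.IsMaximal) ∧
          ∀ 𝒟 : VacuumCauchyDevelopment D, 𝒟.IsMaximal →
            HasCompleteNullInfinity 𝒟.toCauchyDevelopment) ∧
        ∀ 𝒟 : VacuumCauchyDevelopment D, 𝒟.IsMaximal →
          HasCompleteNullInfinity 𝒟.toCauchyDevelopment ∧
            ((∃ (O : Set 𝒟.carrier) (d₀ : FinalStateDecomposition 𝒟.toSpacetime O 0),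
                O = exteriorOf 𝒟.toCauchyDevelopment d₀.charted ∧
                  RaysStayInClosure 𝒟.toCauchyDevelopment O ∧ HasExhaustiveCharts d₀ ∧
                    IsFutureOriented d₀) →
              ∃ (O : Set 𝒟.carrier) (d : FinalStateDecomposition 𝒟.toSpacetime O 2),
                (∀ i, Kerr.IsSubextremal (d.mass i) (d.spin i)) ∧
                  O = exteriorOf 𝒟.toCauchyDevelopment d.charted ∧
                    RaysStayInClosure 𝒟.toCauchyDevelopment O ∧ HasExhaustiveCharts d ∧
                      IsFutureOriented d) :=
    fun D hP ↦ ⟨⟨hP.1, fun 𝒟 hmax ↦ (hP.2 𝒟 hmax).1⟩,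
      fun 𝒟 hmax ↦ ⟨(hP.2 𝒟 hmax).1, fun _ ↦ (hP.2 𝒟 hmax).2⟩⟩
  -- so the base datum is exceptional for the summit's matrix, and the summit kicks it
  obtain ⟨e', F', hF', himm, h0, hinj, hadm', hE⟩ := h X (F 0) ⟨hadm 0, fun hP ↦ hbase (key (F 0) hP)⟩
  refine ⟨e', F', hF', h0, hinj, himm, hadm', 1, one_pos, fun c hc _ ↦ ?_⟩
  exact key (F' c) (Classical.not_not.mp fun hP ↦ hE c hc ⟨hadm' c, hP⟩)

/-- **Measure of the v3 line: modulo tame censorship (W) and pointwise honest C⁰ settling (A), the settling kick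
IS the summit.** (`→`: `settlingKick_of_finalStateConjecture`, using neither; `←`:
`finalStateConjecture_of_settlingKick`.) [folklore] -/
theorem finalStateConjecture_iff_settlingKick
    (hW : ∀ (X : Type) [TopologicalSpace X] [ChartedSpace E3 X] [IsManifold (𝓡 3) ∞ X] [T2Space X]
      [SecondCountableTopology X] [ConnectedSpace X],
      InitialDataSet.IsTameChristodoulouGeneric (admissibleVacuumData X)
        (fun D ↦ (∃ 𝒟 : VacuumCauchyDevelopment D, 𝒟.IsMaximal) ∧
          ∀ 𝒟 : VacuumCauchyDevelopment D, 𝒟.IsMaximal →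
            HasCompleteNullInfinity 𝒟.toCauchyDevelopment) 1)
    (hA : ∀ (X : Type) [TopologicalSpace X] [ChartedSpace E3 X] [IsManifold (𝓡 3) ∞ X] [T2Space X]
      [SecondCountableTopology X] [ConnectedSpace X],
      ∀ D ∈ admissibleVacuumData X, ∀ 𝒟 : VacuumCauchyDevelopment D, 𝒟.IsMaximal →
        HasCompleteNullInfinity 𝒟.toCauchyDevelopment →
          ∃ (O : Set 𝒟.carrier) (d : FinalStateDecomposition 𝒟.toSpacetime O 0),
            O = exteriorOf 𝒟.toCauchyDevelopment d.charted ∧ RaysStayInClosure 𝒟.toCauchyDevelopment O ∧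
              HasExhaustiveCharts d ∧ IsFutureOriented d) :
    _root_.FinalStateConjecture ↔
    ∀ (X : Type) [TopologicalSpace X] [ChartedSpace E3 X] [IsManifold (𝓡 3) ∞ X] [T2Space X]
      [SecondCountableTopology X] [ConnectedSpace X],
      ∀ (e : AFEnd X) (F : EuclideanSpace ℝ (Fin 1) → InitialDataSet (𝓡 3) X),
        InitialDataSet.IsTameDataFamily e 1 F →
          ((InitialDataSet.IsImmersedAtZero 1 F ∧ Function.Injective F) ∨ ∀ c, F c = F 0) →
          (∀ c, F c ∈ admissibleVacuumData X) →
          (∀ c ≠ 0, (∃ 𝒟 : VacuumCauchyDevelopment (F c), 𝒟.IsMaximal) ∧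
              ∀ 𝒟 : VacuumCauchyDevelopment (F c), 𝒟.IsMaximal →
                HasCompleteNullInfinity 𝒟.toCauchyDevelopment) →
          ¬ (((∃ 𝒟 : VacuumCauchyDevelopment (F 0), 𝒟.IsMaximal) ∧
                ∀ 𝒟 : VacuumCauchyDevelopment (F 0), 𝒟.IsMaximal →
                  HasCompleteNullInfinity 𝒟.toCauchyDevelopment) ∧
              ∀ 𝒟 : VacuumCauchyDevelopment (F 0), 𝒟.IsMaximal →
                HasCompleteNullInfinity 𝒟.toCauchyDevelopment ∧
                  ((∃ (O : Set 𝒟.carrier) (d₀ : FinalStateDecomposition 𝒟.toSpacetime O 0),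
                      O = exteriorOf 𝒟.toCauchyDevelopment d₀.charted ∧
                        RaysStayInClosure 𝒟.toCauchyDevelopment O ∧ HasExhaustiveCharts d₀ ∧
                          IsFutureOriented d₀) →
                    ∃ (O : Set 𝒟.carrier) (d : FinalStateDecomposition 𝒟.toSpacetime O 2),
                      (∀ i, Kerr.IsSubextremal (d.mass i) (d.spin i)) ∧
                        O = exteriorOf 𝒟.toCauchyDevelopment d.charted ∧
                          RaysStayInClosure 𝒟.toCauchyDevelopment O ∧ HasExhaustiveCharts d ∧
                            IsFutureOriented d)) →
          ∃ (e' : AFEnd X) (F' : EuclideanSpace ℝ (Fin 1) → InitialDataSet (𝓡 3) X),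
            InitialDataSet.IsTameDataFamily e' 1 F' ∧ F' 0 = F 0 ∧ Function.Injective F' ∧
              InitialDataSet.IsImmersedAtZero 1 F' ∧ (∀ c, F' c ∈ admissibleVacuumData X) ∧
              ∃ ε₀ > (0 : ℝ), ∀ c : EuclideanSpace ℝ (Fin 1), c ≠ 0 → ‖c‖ < ε₀ →
                ((∃ 𝒟 : VacuumCauchyDevelopment (F' c), 𝒟.IsMaximal) ∧
                    ∀ 𝒟 : VacuumCauchyDevelopment (F' c), 𝒟.IsMaximal →
                      HasCompleteNullInfinity 𝒟.toCauchyDevelopment) ∧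
                  ∀ 𝒟 : VacuumCauchyDevelopment (F' c), 𝒟.IsMaximal →
                    HasCompleteNullInfinity 𝒟.toCauchyDevelopment ∧
                      ((∃ (O : Set 𝒟.carrier) (d₀ : FinalStateDecomposition 𝒟.toSpacetime O 0),
                          O = exteriorOf 𝒟.toCauchyDevelopment d₀.charted ∧
                            RaysStayInClosure 𝒟.toCauchyDevelopment O ∧ HasExhaustiveCharts d₀ ∧
                              IsFutureOriented d₀) →
                        ∃ (O : Set 𝒟.carrier) (d : FinalStateDecomposition 𝒟.toSpacetime O 2),
                          (∀ i, Kerr.IsSubextremal (d.mass i) (d.spin i)) ∧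
                            O = exteriorOf 𝒟.toCauchyDevelopment d.charted ∧
                              RaysStayInClosure 𝒟.toCauchyDevelopment O ∧ HasExhaustiveCharts d ∧
                                IsFutureOriented d) :=
  ⟨settlingKick_of_finalStateConjecture, finalStateConjecture_of_settlingKick hW hA⟩

/-- **The v2 kick R (`stub_unparkingKick`) is necessary as well**: the summit's honest C² sub-extremal
decomposition of an MGHD is, read in C⁰ through `FinalStateDecomposition.ofLE` (`hasExhaustiveCharts_ofLE`,
`isFutureOriented_ofLE`, `charted_ofLE`), an honest C⁰ configuration with sub-extremal labels, so the summit's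
witness curve through the base datum is an un-parking kick (`ε₀ := 1`). [folklore] -/
theorem unparkingKick_of_finalStateConjecture (h : _root_.FinalStateConjecture) :
    ∀ (X : Type) [TopologicalSpace X] [ChartedSpace E3 X] [IsManifold (𝓡 3) ∞ X] [T2Space X]
      [SecondCountableTopology X] [ConnectedSpace X],
      ∀ (e : AFEnd X) (F : EuclideanSpace ℝ (Fin 1) → InitialDataSet (𝓡 3) X),
        InitialDataSet.IsTameDataFamily e 1 F →
          ((InitialDataSet.IsImmersedAtZero 1 F ∧ Function.Injective F) ∨ ∀ c, F c = F 0) →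
          (∀ c, F c ∈ admissibleVacuumData X) →
          (∀ c ≠ 0, (∃ 𝒟 : VacuumCauchyDevelopment (F c), 𝒟.IsMaximal) ∧
              ∀ 𝒟 : VacuumCauchyDevelopment (F c), 𝒟.IsMaximal →
                HasCompleteNullInfinity 𝒟.toCauchyDevelopment) →
          ¬ (((∃ 𝒟 : VacuumCauchyDevelopment (F 0), 𝒟.IsMaximal) ∧
                ∀ 𝒟 : VacuumCauchyDevelopment (F 0), 𝒟.IsMaximal →
                  HasCompleteNullInfinity 𝒟.toCauchyDevelopment) ∧
              ∀ 𝒟 : VacuumCauchyDevelopment (F 0), 𝒟.IsMaximal →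
                HasCompleteNullInfinity 𝒟.toCauchyDevelopment ∧
                  ((∃ (O : Set 𝒟.carrier) (d₀ : FinalStateDecomposition 𝒟.toSpacetime O 0),
                      O = exteriorOf 𝒟.toCauchyDevelopment d₀.charted ∧
                        RaysStayInClosure 𝒟.toCauchyDevelopment O ∧ HasExhaustiveCharts d₀ ∧
                          IsFutureOriented d₀) →
                    ∃ (O : Set 𝒟.carrier) (d : FinalStateDecomposition 𝒟.toSpacetime O 0),
                      (∀ i, Kerr.IsSubextremal (d.mass i) (d.spin i)) ∧
                        O = exteriorOf 𝒟.toCauchyDevelopment d.charted ∧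
                          RaysStayInClosure 𝒟.toCauchyDevelopment O ∧ HasExhaustiveCharts d ∧
                            IsFutureOriented d)) →
          ∃ (e' : AFEnd X) (F' : EuclideanSpace ℝ (Fin 1) → InitialDataSet (𝓡 3) X),
            InitialDataSet.IsTameDataFamily e' 1 F' ∧ F' 0 = F 0 ∧ Function.Injective F' ∧
              InitialDataSet.IsImmersedAtZero 1 F' ∧ (∀ c, F' c ∈ admissibleVacuumData X) ∧
              ∃ ε₀ > (0 : ℝ), ∀ c : EuclideanSpace ℝ (Fin 1), c ≠ 0 → ‖c‖ < ε₀ →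
                ((∃ 𝒟 : VacuumCauchyDevelopment (F' c), 𝒟.IsMaximal) ∧
                    ∀ 𝒟 : VacuumCauchyDevelopment (F' c), 𝒟.IsMaximal →
                      HasCompleteNullInfinity 𝒟.toCauchyDevelopment) ∧
                  ∀ 𝒟 : VacuumCauchyDevelopment (F' c), 𝒟.IsMaximal →
                    HasCompleteNullInfinity 𝒟.toCauchyDevelopment ∧
                      ((∃ (O : Set 𝒟.carrier) (d₀ : FinalStateDecomposition 𝒟.toSpacetime O 0),
                          O = exteriorOf 𝒟.toCauchyDevelopment d₀.charted ∧
                            RaysStayInClosure 𝒟.toCauchyDevelopment O ∧ HasExhaustiveCharts d₀ ∧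
                              IsFutureOriented d₀) →
                        ∃ (O : Set 𝒟.carrier) (d : FinalStateDecomposition 𝒟.toSpacetime O 0),
                          (∀ i, Kerr.IsSubextremal (d.mass i) (d.spin i)) ∧
                            O = exteriorOf 𝒟.toCauchyDevelopment d.charted ∧
                              RaysStayInClosure 𝒟.toCauchyDevelopment O ∧ HasExhaustiveCharts d ∧
                                IsFutureOriented d) := by
  intro X _ _ _ _ _ _ e F _hF _hdich hadm _hcens hbase
  -- the summit's matrix at a datum implies censored ∧ un-parked there (read the C² witness in C⁰)
  have key : ∀ D : InitialDataSet (𝓡 3) X,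
      ((∃ 𝒟 : VacuumCauchyDevelopment D, 𝒟.IsMaximal) ∧
        ∀ 𝒟 : VacuumCauchyDevelopment D, 𝒟.IsMaximal →
          HasCompleteNullInfinity 𝒟.toCauchyDevelopment ∧
            ∃ (O : Set 𝒟.carrier) (d : FinalStateDecomposition 𝒟.toSpacetime O 2),
              (∀ i, Kerr.IsSubextremal (d.mass i) (d.spin i)) ∧
                O = exteriorOf 𝒟.toCauchyDevelopment d.charted ∧
                  RaysStayInClosure 𝒟.toCauchyDevelopment O ∧ HasExhaustiveCharts d ∧
                    IsFutureOriented d) →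
      ((∃ 𝒟 : VacuumCauchyDevelopment D, 𝒟.IsMaximal) ∧
          ∀ 𝒟 : VacuumCauchyDevelopment D, 𝒟.IsMaximal →
            HasCompleteNullInfinity 𝒟.toCauchyDevelopment) ∧
        ∀ 𝒟 : VacuumCauchyDevelopment D, 𝒟.IsMaximal →
          HasCompleteNullInfinity 𝒟.toCauchyDevelopment ∧
            ((∃ (O : Set 𝒟.carrier) (d₀ : FinalStateDecomposition 𝒟.toSpacetime O 0),
                O = exteriorOf 𝒟.toCauchyDevelopment d₀.charted ∧
                  RaysStayInClosure 𝒟.toCauchyDevelopment O ∧ HasExhaustiveCharts d₀ ∧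
                    IsFutureOriented d₀) →
              ∃ (O : Set 𝒟.carrier) (d : FinalStateDecomposition 𝒟.toSpacetime O 0),
                (∀ i, Kerr.IsSubextremal (d.mass i) (d.spin i)) ∧
                  O = exteriorOf 𝒟.toCauchyDevelopment d.charted ∧
                    RaysStayInClosure 𝒟.toCauchyDevelopment O ∧ HasExhaustiveCharts d ∧
                      IsFutureOriented d) := by
    intro D hP
    refine ⟨⟨hP.1, fun 𝒟 hmax ↦ (hP.2 𝒟 hmax).1⟩, fun 𝒟 hmax ↦ ⟨(hP.2 𝒟 hmax).1, fun _ ↦ ?_⟩⟩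
    obtain ⟨O, d, hsub, hO, hRay, hExh, hFut⟩ := (hP.2 𝒟 hmax).2
    exact ⟨O, d.ofLE (Nat.zero_le 2), hsub, by rwa [FinalStateDecomposition.charted_ofLE], hRay,
      hasExhaustiveCharts_ofLE d _ hExh, (isFutureOriented_ofLE d _).2 hFut⟩
  obtain ⟨e', F', hF', himm, h0, hinj, hadm', hE⟩ := h X (F 0) ⟨hadm 0, fun hP ↦ hbase (key (F 0) hP)⟩
  refine ⟨e', F', hF', h0, hinj, himm, hadm', 1, one_pos, fun c hc _ ↦ ?_⟩
  exact key (F' c) (Classical.not_not.mp fun hP ↦ hE c hc ⟨hadm' c, hP⟩)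

end Summit.FinalStateConjecture.FinalStateConjecture.Theorems.PhaseMixingCaptureCaptureSufficesTame

end
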